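import Literature.Dynamics.Tilings.TorusCNFGluingLifts
import HarnessLib

/-!
# Extending a good lift by one cell (toolkit for the gluing width bound, II)

Topic `Literature/Dynamics/Tilings`. Continuation of `TorusCNFGluingLifts.lean`. When Prover
pebbles a new cell `c` of the torus, Duplicator re-lifts the clusters of the old pebbled set `S`
that come torus-`g`-close to `c` ("touched" clusters): each is translated by a vector divisible by
`n` so that its cells near `c` sit at their minimal displacement from the canonical lift
`P = (c.1, c.2)` of `c`; untouched clusters stay. This file proves that such translation vectors
exist and that the extended lift is again good:

* `Touched g n S c a` — the cell `a` lies in a cluster of `S` containing a cell torus-`g`-close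
  to `c`; closure under proximity steps (`Touched.step`);
* `exists_transl` — under `g · (|S| + 1) < n` there are translation vectors `τ a`, zero on
  untouched cells, divisible by `n`, constant on touched clusters, placing every cell of `S` that
  is torus-`g`-close to `c` within sup-distance `g` of `P` (by the cluster diameter lemma and the
  forcing of small representatives);
* `goodLift_extend` — the lift `a ↦ L a + τ a` on `S`, `c ↦ P`, is a good lift of `insert c S`;
* `separated_of_ne_transl`, `separated_of_not_touched` — lifted images of distinct re-lifted
  clusters, and of re-lifted versus untouched cells, are at sup-distance `> g` (so that plane
  tilings can be glued along them, `TorusCNFGluingWidth.lean`).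

Elementary; [folklore] tags (the game is Atserias–Dalmau's, J. Comput. Syst. Sci. 74 (2008)).
-/

namespace Literature.Dynamics.Tilings

namespace TorusGluing

open Finset

/-! ### Touched cells -/

/-- The cell `a` is **touched** by the new cell `c`: some cell `a₀ ∈ S` torus-`g`-close to `c`
lies in the cluster of `a` (is joined to `a` in the `g`-proximity graph of `S`). [folklore] -/
def Touched (g n : ℕ) (S : Finset (ℕ × ℕ)) (c a : ℕ × ℕ) : Prop :=
  ∃ a₀ ∈ S, TClose g n c a₀ ∧ (proxGraph g n S).Reachable a₀ a

/-- A touched cell belongs to `S`. [folklore] -/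
theorem Touched.mem {g n : ℕ} {S : Finset (ℕ × ℕ)} {c a : ℕ × ℕ} (h : Touched g n S c a) : a ∈ S := by
  obtain ⟨a₀, ha₀, -, hr⟩ := h
  exact mem_of_reachable hr ha₀

/-- A cell of `S` torus-`g`-close to `c` is touched. [folklore] -/
theorem Touched.of_tclose {g n : ℕ} {S : Finset (ℕ × ℕ)} {c a : ℕ × ℕ} (ha : a ∈ S)
    (h : TClose g n c a) : Touched g n S c a :=
  ⟨a, ha, h, SimpleGraph.Reachable.refl _⟩

/-- Touched cells are closed under reachability. [folklore] -/
theorem Touched.of_reachable {g n : ℕ} {S : Finset (ℕ × ℕ)} {c a b : ℕ × ℕ}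
    (h : Touched g n S c a) (hab : (proxGraph g n S).Reachable a b) : Touched g n S c b := by
  obtain ⟨a₀, ha₀, hc, hr⟩ := h
  exact ⟨a₀, ha₀, hc, hr.trans hab⟩

/-- Torus-`g`-close cells of `S` are joined in the proximity graph. [folklore] -/
theorem reachable_of_tclose {g n : ℕ} {S : Finset (ℕ × ℕ)} {a b : ℕ × ℕ} (ha : a ∈ S) (hb : b ∈ S)
    (hab : TClose g n a b) : (proxGraph g n S).Reachable a b := by
  by_cases h : a = b
  · subst h; exact SimpleGraph.Reachable.refl _
  · exact SimpleGraph.Adj.reachable (show (proxGraph g n S).Adj a b from ⟨h, ha, hb, hab⟩)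

/-- Touched cells are closed under proximity steps inside `S`. [folklore] -/
theorem Touched.step {g n : ℕ} {S : Finset (ℕ × ℕ)} {c a b : ℕ × ℕ}
    (h : Touched g n S c a) (hb : b ∈ S) (hab : TClose g n a b) : Touched g n S c b :=
  h.of_reachable (reachable_of_tclose h.mem hb hab)

/-! ### Translation vectors -/

/-- The canonical lift of a cell. [folklore] -/
def canon (c : ℕ × ℕ) : ℤ × ℤ := ((c.1 : ℤ), (c.2 : ℤ))

/-- The canonical lift is congruent to its cell. [folklore] -/
theorem cong_canon (n : ℕ) (c : ℕ × ℕ) : Cong n (canon c) c := cong_self n c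

/-- `supDist P (P + d)` is the sup-norm of `d`. [folklore] -/
theorem supDist_self_add (P d : ℤ × ℤ) : supDist P (P + d) = max |d.1| |d.2| := by
  simp [supDist]

/-- **Translation vectors exist.** Let `L` be a good lift of `S` and `c` a cell with
`g · (|S| + 1) < n`. There is `τ : cells → ℤ²` with: `τ a = 0` on untouched cells; `τ a`
divisible by `n`; `τ` constant along the proximity graph on touched cells; and every cell of `S`
torus-`g`-close to `c` is moved to within sup-distance `g` of the canonical lift of `c`.
(Choose in each touched cluster an anchor `a₀` close to `c` with small displacement `d₀` and
translate by `P + d₀ - L a₀`; independence of the choice and the last property follow from the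
cluster diameter bound `g(|S|-1)` and `eq_of_cong_of_lt`.) [folklore] -/
theorem exists_transl {g n : ℕ} {S : Finset (ℕ × ℕ)} {L : ℕ × ℕ → ℤ × ℤ} (hL : GoodLift g n S L)
    (c : ℕ × ℕ) (hsmall : (g : ℤ) * (S.card + 1) < n) :
    ∃ τ : ℕ × ℕ → ℤ × ℤ,
      (∀ a, ¬ Touched g n S c a → τ a = 0) ∧
      (∀ a, Touched g n S c a → (n : ℤ) ∣ (τ a).1 ∧ (n : ℤ) ∣ (τ a).2) ∧
      (∀ a b, Touched g n S c a → (proxGraph g n S).Reachable a b → τ a = τ b) ∧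
      (∀ a ∈ S, TClose g n c a → supDist (canon c) (L a + τ a) ≤ g) := by
  classical
  -- anchors and displacements
  let P : ℤ × ℤ := canon c
  let τ : ℕ × ℕ → ℤ × ℤ := fun a =>
    if h : Touched g n S c a then P + h.choose_spec.2.1.choose - L h.choose else 0
  have hg0 : (0 : ℤ) ≤ g := by positivity
  have hdiam : ∀ {a b : ℕ × ℕ}, a ∈ S → (proxGraph g n S).Reachable a b →
      |(L a).1 - (L b).1| ≤ g * (S.card - 1 : ℤ) ∧ |(L a).2 - (L b).2| ≤ g * (S.card - 1 : ℤ) :=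
    fun ha hr => supDist_le_iff.1 (supDist_le_of_reachable hL ha hr)
  -- unpacking `τ` on a touched cell
  have hτ : ∀ {a : ℕ × ℕ} (h : Touched g n S c a),
      ∃ a₀ ∈ S, ∃ d₀ : ℤ × ℤ, (proxGraph g n S).Reachable a₀ a ∧ |d₀.1| ≤ g ∧ |d₀.2| ≤ g ∧
        (n : ℤ) ∣ d₀.1 - ((a₀.1 : ℤ) - c.1) ∧ (n : ℤ) ∣ d₀.2 - ((a₀.2 : ℤ) - c.2) ∧
        τ a = P + d₀ - L a₀ := by
    intro a h
    refine ⟨h.choose, h.choose_spec.1, h.choose_spec.2.1.choose, h.choose_spec.2.2,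
      h.choose_spec.2.1.choose_spec.1, h.choose_spec.2.1.choose_spec.2.1,
      h.choose_spec.2.1.choose_spec.2.2.1, h.choose_spec.2.1.choose_spec.2.2.2, ?_⟩
    simp only [τ, dif_pos h]
  refine ⟨τ, fun a h => by simp only [τ, dif_neg h], fun a h => ?_, fun a b h hab => ?_,
    fun a ha hca => ?_⟩
  · -- divisibility
    obtain ⟨a₀, ha₀, d₀, -, -, -, hd3, hd4, he⟩ := hτ h
    have hc0 := hL.cong a₀ ha₀
    rw [he]
    refine ⟨?_, ?_⟩
    · have e : (P + d₀ - L a₀).1 = (d₀.1 - ((a₀.1 : ℤ) - c.1)) - ((L a₀).1 - a₀.1) := by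
        simp only [Prod.fst_sub, Prod.fst_add, P, canon]; ring
      rw [e]; exact dvd_sub hd3 hc0.1
    · have e : (P + d₀ - L a₀).2 = (d₀.2 - ((a₀.2 : ℤ) - c.2)) - ((L a₀).2 - a₀.2) := by
        simp only [Prod.snd_sub, Prod.snd_add, P, canon]; ring
      rw [e]; exact dvd_sub hd4 hc0.2
  · -- constant on clusters
    obtain ⟨a₀, ha₀, d₀, hr₀, h1, h2, h3, h4, he⟩ := hτ h
    obtain ⟨b₀, hb₀, e₀, hs₀, k1, k2, k3, k4, ke⟩ := hτ (h.of_reachable hab)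
    have hreach : (proxGraph g n S).Reachable a₀ b₀ := (hr₀.trans hab).trans hs₀.symm
    have hd := supDist_le_of_reachable hL ha₀ hreach
    have key : L b₀ - L a₀ = e₀ - d₀ := by
      refine sub_eq_of_tclose (g := 2 * g) (hL.cong a₀ ha₀) (hL.cong b₀ hb₀) ?_ ?_ ?_ ?_ ?_
      · calc |(e₀ - d₀).1| = |e₀.1 - d₀.1| := rfl
          _ ≤ |e₀.1| + |d₀.1| := abs_sub _ _
          _ ≤ (2 * g : ℕ) := by push_cast; linarith
      · calc |(e₀ - d₀).2| = |e₀.2 - d₀.2| := rfl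
          _ ≤ |e₀.2| + |d₀.2| := abs_sub _ _
          _ ≤ (2 * g : ℕ) := by push_cast; linarith
      · have e : (e₀ - d₀).1 - ((b₀.1 : ℤ) - a₀.1) =
            (e₀.1 - ((b₀.1 : ℤ) - c.1)) - (d₀.1 - ((a₀.1 : ℤ) - c.1)) := by
          simp only [Prod.fst_sub]; ring
        rw [e]; exact dvd_sub k3 h3
      · have e : (e₀ - d₀).2 - ((b₀.2 : ℤ) - a₀.2) =
            (e₀.2 - ((b₀.2 : ℤ) - c.2)) - (d₀.2 - ((a₀.2 : ℤ) - c.2)) := by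
          simp only [Prod.snd_sub]; ring
        rw [e]; exact dvd_sub k4 h4
      · push_cast; nlinarith
    rw [he, ke]
    have k1' := congrArg Prod.fst key
    have k2' := congrArg Prod.snd key
    simp only [Prod.fst_sub, Prod.snd_sub] at k1' k2'
    ext <;> simp only [Prod.fst_sub, Prod.fst_add, Prod.snd_sub, Prod.snd_add] <;> linarith
  · -- cells close to `c` land close to `P`
    have h : Touched g n S c a := Touched.of_tclose ha hca
    obtain ⟨a₀, ha₀, d₀, hr₀, h1, h2, h3, h4, he⟩ := hτ h
    obtain ⟨d, hd1, hd2, hd3, hd4⟩ := hca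
    obtain ⟨j1, j2⟩ := hdiam ha₀ hr₀
    have hca0 := hL.cong a ha
    have hc0 := hL.cong a₀ ha₀
    have key : L a + τ a - P = d := by
      refine eq_of_cong_of_lt (n := n) ?_ ?_ ?_ ?_
      · have e : (L a + τ a - P).1 - d.1 = ((L a).1 - a.1) - ((L a₀).1 - a₀.1) +
            (d₀.1 - ((a₀.1 : ℤ) - c.1)) - (d.1 - ((a.1 : ℤ) - c.1)) := by
          rw [he]; simp only [Prod.fst_sub, Prod.fst_add, P, canon]; ring
        rw [e]; exact dvd_sub (dvd_add (dvd_sub hca0.1 hc0.1) h3) hd3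
      · have e : (L a + τ a - P).2 - d.2 = ((L a).2 - a.2) - ((L a₀).2 - a₀.2) +
            (d₀.2 - ((a₀.2 : ℤ) - c.2)) - (d.2 - ((a.2 : ℤ) - c.2)) := by
          rw [he]; simp only [Prod.snd_sub, Prod.snd_add, P, canon]; ring
        rw [e]; exact dvd_sub (dvd_add (dvd_sub hca0.2 hc0.2) h4) hd4
      · have e : (L a + τ a - P).1 - d.1 = -((L a₀).1 - (L a).1) + d₀.1 - d.1 := by
          rw [he]; simp only [Prod.fst_sub, Prod.fst_add]; ring
        rw [e]
        calc |-((L a₀).1 - (L a).1) + d₀.1 - d.1|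
            ≤ |-((L a₀).1 - (L a).1) + d₀.1| + |d.1| := abs_sub _ _
          _ ≤ |-((L a₀).1 - (L a).1)| + |d₀.1| + |d.1| := by linarith [abs_add_le (-((L a₀).1 - (L a).1)) d₀.1]
          _ = |(L a₀).1 - (L a).1| + |d₀.1| + |d.1| := by rw [abs_neg]
          _ < n := by nlinarith
      · have e : (L a + τ a - P).2 - d.2 = -((L a₀).2 - (L a).2) + d₀.2 - d.2 := by
          rw [he]; simp only [Prod.snd_sub, Prod.snd_add]; ring
        rw [e]
        calc |-((L a₀).2 - (L a).2) + d₀.2 - d.2|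
            ≤ |-((L a₀).2 - (L a).2) + d₀.2| + |d.2| := abs_sub _ _
          _ ≤ |-((L a₀).2 - (L a).2)| + |d₀.2| + |d.2| := by linarith [abs_add_le (-((L a₀).2 - (L a).2)) d₀.2]
          _ = |(L a₀).2 - (L a).2| + |d₀.2| + |d.2| := by rw [abs_neg]
          _ < n := by nlinarith
    have : L a + τ a = P + d := by rw [← key]; abel
    rw [this, supDist_self_add]
    exact max_le hd1 hd2

/-! ### The extended lift -/

/-- **The extended lift is good.** With translation vectors as in `exists_transl`, the lift
`a ↦ L a + τ a` on `S` together with `c ↦ P` is a good lift of `insert c S` (meant for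
`c ∉ S`, where the two prescriptions of `L'` are compatible). [folklore] -/
theorem goodLift_extend {g n : ℕ} {S : Finset (ℕ × ℕ)} {L : ℕ × ℕ → ℤ × ℤ} (hL : GoodLift g n S L)
    {c : ℕ × ℕ} {τ : ℕ × ℕ → ℤ × ℤ}
    (h0 : ∀ a, ¬ Touched g n S c a → τ a = 0)
    (h1 : ∀ a, Touched g n S c a → (n : ℤ) ∣ (τ a).1 ∧ (n : ℤ) ∣ (τ a).2)
    (h2 : ∀ a b, Touched g n S c a → (proxGraph g n S).Reachable a b → τ a = τ b)
    (h3 : ∀ a ∈ S, TClose g n c a → supDist (canon c) (L a + τ a) ≤ g)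
    {L' : ℕ × ℕ → ℤ × ℤ} (hL'c : L' c = canon c) (hL'S : ∀ a ∈ S, L' a = L a + τ a) :
    GoodLift g n (insert c S) L' := by
  classical
  have hcongS : ∀ a ∈ S, Cong n (L' a) a := by
    intro a ha
    rw [hL'S a ha]
    by_cases ht : Touched g n S c a
    · obtain ⟨k1, k2⟩ := h1 a ht
      have := hL.cong a ha
      refine ⟨?_, ?_⟩
      · have e : (L a + τ a).1 - (a.1 : ℤ) = ((L a).1 - a.1) + (τ a).1 := by
          simp only [Prod.fst_add]; ring
        rw [e]; exact dvd_add this.1 k1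
      · have e : (L a + τ a).2 - (a.2 : ℤ) = ((L a).2 - a.2) + (τ a).2 := by
          simp only [Prod.snd_add]; ring
        rw [e]; exact dvd_add this.2 k2
    · rw [h0 a ht, add_zero]; exact hL.cong a ha
  refine ⟨fun a ha => ?_, fun a ha b hb hab => ?_⟩
  · rcases Finset.mem_insert.1 ha with hac | ha
    · rw [hac, hL'c]; exact cong_canon n _
    · exact hcongS a ha
  · rcases Finset.mem_insert.1 ha with hac | ha' <;> rcases Finset.mem_insert.1 hb with hbc | hb'
    · rw [hac, hbc, supDist_self]; positivity
    · rw [hac, hL'c, hL'S b hb']; rw [hac] at hab; exact h3 b hb' hab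
    · rw [hbc, hL'c, hL'S a ha', supDist_comm]; rw [hbc] at hab; exact h3 a ha' hab.symm
    · rw [hL'S a ha', hL'S b hb']
      have hτ : τ a = τ b := by
        by_cases ht : Touched g n S c a
        · exact h2 a b ht (reachable_of_tclose ha' hb' hab)
        · have ht' : ¬ Touched g n S c b := fun htb => ht (htb.step ha' hab.symm)
          rw [h0 a ht, h0 b ht']
      rw [hτ, supDist_add_right]
      exact hL.close a ha' b hb' hab

/-! ### Separation of the re-lifted clusters -/

/-- Lifted images of touched cells with different translation vectors are at sup-distance `> g`.
[folklore] -/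
theorem separated_of_ne_transl {g n : ℕ} {S : Finset (ℕ × ℕ)} {L : ℕ × ℕ → ℤ × ℤ}
    (hL : GoodLift g n S L) {c : ℕ × ℕ} {τ : ℕ × ℕ → ℤ × ℤ}
    (h1 : ∀ a, Touched g n S c a → (n : ℤ) ∣ (τ a).1 ∧ (n : ℤ) ∣ (τ a).2)
    (h2 : ∀ a b, Touched g n S c a → (proxGraph g n S).Reachable a b → τ a = τ b)
    {a b : ℕ × ℕ} (hta : Touched g n S c a) (htb : Touched g n S c b) (hne : τ a ≠ τ b) :
    (g : ℤ) < supDist (L a + τ a) (L b + τ b) := by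
  by_contra hle
  push Not at hle
  have ha := hta.mem
  have hb := htb.mem
  have hca : Cong n (L a + τ a) a := by
    obtain ⟨k1, k2⟩ := h1 a hta
    have := hL.cong a ha
    exact ⟨by simpa [Prod.fst_add, add_sub_right_comm] using dvd_add this.1 k1,
      by simpa [Prod.snd_add, add_sub_right_comm] using dvd_add this.2 k2⟩
  have hcb : Cong n (L b + τ b) b := by
    obtain ⟨k1, k2⟩ := h1 b htb
    have := hL.cong b hb
    exact ⟨by simpa [Prod.fst_add, add_sub_right_comm] using dvd_add this.1 k1,
      by simpa [Prod.snd_add, add_sub_right_comm] using dvd_add this.2 k2⟩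
  have hab : TClose g n a b := tclose_of_cong_of_supDist_le hca hcb hle
  exact hne (h2 a b hta (reachable_of_tclose ha hb hab))

/-- Lifted images of a touched and an untouched cell are at sup-distance `> g`. [folklore] -/
theorem separated_of_not_touched {g n : ℕ} {S : Finset (ℕ × ℕ)} {L : ℕ × ℕ → ℤ × ℤ}
    (hL : GoodLift g n S L) {c : ℕ × ℕ} {τ : ℕ × ℕ → ℤ × ℤ}
    (h1 : ∀ a, Touched g n S c a → (n : ℤ) ∣ (τ a).1 ∧ (n : ℤ) ∣ (τ a).2)
    {a b : ℕ × ℕ} (hta : Touched g n S c a) (hb : b ∈ S) (htb : ¬ Touched g n S c b) :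
    (g : ℤ) < supDist (L b) (L a + τ a) := by
  by_contra hle
  push Not at hle
  have ha := hta.mem
  have hca : Cong n (L a + τ a) a := by
    obtain ⟨k1, k2⟩ := h1 a hta
    have := hL.cong a ha
    exact ⟨by simpa [Prod.fst_add, add_sub_right_comm] using dvd_add this.1 k1,
      by simpa [Prod.snd_add, add_sub_right_comm] using dvd_add this.2 k2⟩
  have hab : TClose g n b a := tclose_of_cong_of_supDist_le (hL.cong b hb) hca hle
  exact htb (hta.step hb hab.symm)

end TorusGluing

end Literature.Dynamics.Tilings
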